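import Summits.ValiantsHypothesis.ValiantsHypothesis.Theses.FeketeSOS

/-!
# `SOSMagnification` / `FeketeSOSHard` — negative lemma: the hardness exponent δ is at most 1/2

Crux `stmt-ValiantsHypothesis-3995` (`FeketeSOS.SOSMagnification`) is literally
`FeketeSOSHard → ValiantsHypothesis`; its hypothesis X = `FeketeSOSHard` is
`∃ δ > 0, Slice δ` where `Slice δ` says that for all large primes `p` every weighted-SOS
representation `F_p = ∑_{i<s} cᵢ gᵢ²` of the Fekete polynomial with `s ≤ p^δ` squares of degree
`≤ p²` has support-sum `∑ |supp gᵢ| ≥ p^{1/2+δ}`.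

This file records the (elementary, folklore) upper end of the admissible range of δ:
`Slice δ` is FALSE for every `δ > 1/2` (`feketeSOSHard_slice_false_of_half_lt`), because the
dense two-square representation `F_p = ¼(F_p+1)² − ¼(F_p−1)²` (Dutta–Saxena–Thierauf 2024,
eq. (3)) is admitted (`s = 2 ≤ p^δ`, degrees `p − 1 ≤ p²`) and has support-sum `≤ 2p < p^{1/2+δ}`
for large `p`.  Hence any δ witnessing X satisfies `δ ≤ 1/2` (`feketeSOSHard_delta_le_half`,
`exists_delta_le_half_of_feketeSOSHard`): X asks exactly for a polynomial gain inside the window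
`[√(2(p−1)), 2p]` between the trivial counting bound and the dense representation, and the
magnification (DST24 Thm 3.2/3.9 with `k = ⌈6^{1/δ}⌉+1`) is only ever invoked with `δ ≤ 1/2`.
Standing-disprover work file: `Cruxes/SOSMagnification/Disproof.lean`.

References: P. Dutta, N. Saxena, T. Thierauf, comput. complexity 33 (2024), eq. (2)–(3)
[DuttaSaxenaThierauf2024].
-/

namespace Summit.ValiantsHypothesis.ValiantsHypothesis.Theorems.SOSMagnification.Negative

open Polynomial
open scoped BigOperators

/-- **The dense two-square representation** `F = ¼(F+1)² − ¼(F−1)²` (DST24 eq. (3)) in the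
typing of the route items (`Fin 2`-indexed weights and polynomials).
[cite: DuttaSaxenaThierauf2024, eq. (3)] -/
theorem two_squares (F : Polynomial ℂ) :
    (∑ i, C ((![(4 : ℂ)⁻¹, -(4 : ℂ)⁻¹]) i) * (![F + 1, F - 1]) i ^ 2) = F := by
  simp only [Fin.sum_univ_two, Matrix.cons_val_zero, Matrix.cons_val_one]
  have h4 : (C (4 : ℂ)⁻¹ : Polynomial ℂ) * 4 = 1 := by
    rw [← map_ofNat C 4, ← C_mul, inv_mul_cancel₀ (by norm_num), C_1]
  have : C (4 : ℂ)⁻¹ * (F + 1) ^ 2 + C (-(4 : ℂ)⁻¹) * (F - 1) ^ 2 = C (4 : ℂ)⁻¹ * 4 * F := by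
    rw [map_neg]; ring
  rw [this, h4, one_mul]

/-- `deg F_p < p` for the Fekete polynomial as inlined in the route items. [folklore] -/
theorem natDegree_fekete_lt (p : ℕ) [Fact p.Prime] :
    (∑ m ∈ Finset.range p, C ((legendreSym p m : ℤ) : ℂ) * X ^ m).natDegree < p := by
  have hp : 0 < p := (Fact.out : p.Prime).pos
  refine lt_of_le_of_lt (natDegree_sum_le_of_forall_le _ _ (n := p - 1) fun m hm => ?_) (by omega)
  exact (natDegree_C_mul_X_pow_le _ _).trans (by
    have := Finset.mem_range.1 hm
    omega)

/-- `deg (F + a) < p` if `deg F < p` and `0 < p`. [folklore] -/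
theorem natDegree_add_C_lt {F : Polynomial ℂ} {p : ℕ} (hF : F.natDegree < p) (hp : 0 < p) (a : ℂ) :
    (F + C a).natDegree < p := by
  refine lt_of_le_of_lt (natDegree_add_le _ _) (max_lt hF ?_)
  rw [natDegree_C]; exact hp

/-- `|supp (F + a)| ≤ p` if `deg F < p` and `0 < p`. [folklore] -/
theorem card_support_add_C_le {F : Polynomial ℂ} {p : ℕ} (hF : F.natDegree < p) (hp : 0 < p)
    (a : ℂ) : (F + C a).support.card ≤ p := by
  calc (F + C a).support.card ≤ (Finset.range p).card :=
        Finset.card_le_card (supp_subset_range (natDegree_add_C_lt hF hp a))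
    _ = p := Finset.card_range p

/-- **Negative lemma (δ-range of X).** The δ-slice of `FeketeSOSHard` is false for every
`δ > 1/2`: witness the dense two-square representation at any prime `p ≥ max p₀ 4` with
`p > 2^{1/(δ−1/2)}`. [cite: DuttaSaxenaThierauf2024, eq. (3)] -/
theorem feketeSOSHard_slice_false_of_half_lt {δ : ℝ} (hδ : 1 / 2 < δ) :
    ¬ ∃ p₀ : ℕ, ∀ (p : ℕ) [Fact p.Prime], p₀ ≤ p →
      ∀ (s : ℕ) (c : Fin s → ℂ) (g : Fin s → Polynomial ℂ),
      (s : ℝ) ≤ (p : ℝ) ^ δ → (∀ i, (g i).natDegree ≤ p ^ 2) →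
      (∑ i, Polynomial.C (c i) * g i ^ 2)
        = ∑ m ∈ Finset.range p, Polynomial.C ((legendreSym p m : ℤ) : ℂ) * Polynomial.X ^ m →
      (p : ℝ) ^ (1 / 2 + δ) ≤ ∑ i, ((g i).support.card : ℝ) := by
  rintro ⟨p₀, H⟩
  set N : ℕ := ⌈(2 : ℝ) ^ (1 / (δ - 1 / 2))⌉₊ + 1 with hN
  obtain ⟨p, hp_ge, hp_prime⟩ := Nat.exists_infinite_primes (max p₀ (max 4 N))
  haveI : Fact p.Prime := ⟨hp_prime⟩
  have hp₀ : p₀ ≤ p := le_trans (le_max_left _ _) hp_ge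
  have h4 : 4 ≤ p := le_trans (le_trans (le_max_left _ _) (le_max_right _ _)) hp_ge
  have hNp : N ≤ p := le_trans (le_trans (le_max_right _ _) (le_max_right _ _)) hp_ge
  have hp_pos : (0 : ℝ) < p := by exact_mod_cast hp_prime.pos
  have hp1 : (1 : ℝ) ≤ p := by exact_mod_cast hp_prime.one_lt.le
  have hδ' : 0 < δ - 1 / 2 := by linarith
  set F : Polynomial ℂ := ∑ m ∈ Finset.range p, C ((legendreSym p m : ℤ) : ℂ) * X ^ m with hF
  have hFdeg : F.natDegree < p := natDegree_fekete_lt p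
  -- (1) two squares are admitted: 2 ≤ p^{1/2} ≤ p^δ
  have hsqrt2 : (2 : ℝ) ≤ (p : ℝ) ^ (1 / 2 : ℝ) := by
    have hsq : ((p : ℝ) ^ (1 / 2 : ℝ)) ^ (2 : ℕ) = p := by
      rw [← Real.rpow_mul_natCast hp_pos.le]; norm_num
    refine le_of_pow_le_pow_left₀ two_ne_zero (by positivity) ?_
    rw [hsq]
    have : (4 : ℝ) ≤ p := by exact_mod_cast h4
    linarith
  have hs : ((2 : ℕ) : ℝ) ≤ (p : ℝ) ^ δ :=
    hsqrt2.trans (Real.rpow_le_rpow_of_exponent_le hp1 hδ.le)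
  -- degrees ≤ p²
  have hdeg : ∀ i : Fin 2, ((![F + 1, F - 1]) i).natDegree ≤ p ^ 2 := by
    have hp2 : p ≤ p ^ 2 := Nat.le_self_pow two_ne_zero p
    have hd₁ : (F + 1).natDegree ≤ p ^ 2 := by
      have h := natDegree_add_C_lt hFdeg hp_prime.pos 1
      rw [map_one] at h
      exact h.le.trans hp2
    have hd₂ : (F - 1).natDegree ≤ p ^ 2 := by
      have h := natDegree_add_C_lt hFdeg hp_prime.pos (-1)
      rw [map_neg, map_one, ← sub_eq_add_neg] at h
      exact h.le.trans hp2
    intro i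
    fin_cases i
    · exact hd₁
    · exact hd₂
  have key := H p hp₀ 2 (![(4 : ℂ)⁻¹, -(4 : ℂ)⁻¹]) (![F + 1, F - 1]) hs hdeg (two_squares F)
  -- (2) support-sum ≤ 2p
  have hcard : (∑ i : Fin 2, (((![F + 1, F - 1]) i).support.card : ℝ)) ≤ 2 * p := by
    have h₁ : (F + 1).support.card ≤ p := by
      have h := card_support_add_C_le hFdeg hp_prime.pos 1
      rwa [map_one] at h
    have h₂ : (F - 1).support.card ≤ p := by
      have h := card_support_add_C_le hFdeg hp_prime.pos (-1)
      rwa [map_neg, map_one, ← sub_eq_add_neg] at h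
    simp only [Fin.sum_univ_two, Matrix.cons_val_zero, Matrix.cons_val_one]
    have h₁' : ((F + 1).support.card : ℝ) ≤ p := by exact_mod_cast h₁
    have h₂' : ((F - 1).support.card : ℝ) ≤ p := by exact_mod_cast h₂
    linarith
  -- (3) 2p < p^{1/2+δ} = p · p^{δ-1/2}
  have hgt : (2 : ℝ) < (p : ℝ) ^ (δ - 1 / 2) := by
    have hNreal : (2 : ℝ) ^ (1 / (δ - 1 / 2)) < (p : ℝ) := by
      have h1 : (2 : ℝ) ^ (1 / (δ - 1 / 2)) ≤ (⌈(2 : ℝ) ^ (1 / (δ - 1 / 2))⌉₊ : ℝ) := Nat.le_ceil _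
      have h2 : ((⌈(2 : ℝ) ^ (1 / (δ - 1 / 2))⌉₊ : ℕ) : ℝ) + 1 ≤ (p : ℝ) := by exact_mod_cast hNp
      linarith
    calc (2 : ℝ) = ((2 : ℝ) ^ (1 / (δ - 1 / 2))) ^ (δ - 1 / 2) := by
          rw [← Real.rpow_mul (by norm_num : (0 : ℝ) ≤ 2), one_div, inv_mul_cancel₀ hδ'.ne',
            Real.rpow_one]
      _ < (p : ℝ) ^ (δ - 1 / 2) := Real.rpow_lt_rpow (by positivity) hNreal hδ'
  have hlt : (2 : ℝ) * p < (p : ℝ) ^ (1 / 2 + δ) := by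
    have : (p : ℝ) ^ (1 / 2 + δ) = (p : ℝ) * (p : ℝ) ^ (δ - 1 / 2) := by
      conv_lhs =>
        rw [show 1 / 2 + δ = 1 + (δ - 1 / 2) by ring, Real.rpow_add hp_pos, Real.rpow_one]
    rw [this, mul_comm]
    exact mul_lt_mul_of_pos_left hgt hp_pos
  linarith

/-- **Corollary.** Any δ witnessing `FeketeSOSHard` (the hypothesis of `SOSMagnification`)
satisfies `δ ≤ 1/2`; so DST magnification is only ever invoked with `k = ⌈6^{1/δ}⌉ + 1 ≥ 37`.
[folklore] -/
theorem feketeSOSHard_delta_le_half {δ : ℝ}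
    (h : ∃ p₀ : ℕ, ∀ (p : ℕ) [Fact p.Prime], p₀ ≤ p →
      ∀ (s : ℕ) (c : Fin s → ℂ) (g : Fin s → Polynomial ℂ),
      (s : ℝ) ≤ (p : ℝ) ^ δ → (∀ i, (g i).natDegree ≤ p ^ 2) →
      (∑ i, Polynomial.C (c i) * g i ^ 2)
        = ∑ m ∈ Finset.range p, Polynomial.C ((legendreSym p m : ℤ) : ℂ) * Polynomial.X ^ m →
      (p : ℝ) ^ (1 / 2 + δ) ≤ ∑ i, ((g i).support.card : ℝ)) : δ ≤ 1 / 2 := by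
  by_contra hlt
  exact feketeSOSHard_slice_false_of_half_lt (lt_of_not_ge hlt) h

/-- The same corollary on the route decl: from X one may extract a witness `δ ∈ (0, 1/2]`.
[folklore] -/
theorem exists_delta_le_half_of_feketeSOSHard
    (hX : Summit.ValiantsHypothesis.ValiantsHypothesis.Theses.FeketeSOS.FeketeSOSHard) :
    ∃ δ : ℝ, 0 < δ ∧ δ ≤ 1 / 2 ∧ ∃ p₀ : ℕ, ∀ (p : ℕ) [Fact p.Prime], p₀ ≤ p →
      ∀ (s : ℕ) (c : Fin s → ℂ) (g : Fin s → Polynomial ℂ),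
      (s : ℝ) ≤ (p : ℝ) ^ δ → (∀ i, (g i).natDegree ≤ p ^ 2) →
      (∑ i, Polynomial.C (c i) * g i ^ 2)
        = ∑ m ∈ Finset.range p, Polynomial.C ((legendreSym p m : ℤ) : ℂ) * Polynomial.X ^ m →
      (p : ℝ) ^ (1 / 2 + δ) ≤ ∑ i, ((g i).support.card : ℝ) := by
  obtain ⟨δ, hδ, h⟩ := hX
  exact ⟨δ, hδ, feketeSOSHard_delta_le_half h, h⟩

end Summit.ValiantsHypothesis.ValiantsHypothesis.Theorems.SOSMagnification.Negative
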